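import Literature.NumberTheory.EllipticCurves.NewformGaloisRepIntegralityProofs
import Literature.NumberTheory.EllipticCurves.NewformsCoeffFieldProofs
import Literature.NumberTheory.EllipticCurves.DeligneSerreRankinProofs
import Mathlib.FieldTheory.Extension
import HarnessLib

/-!
# Deligne–Serre 1974, Prop. 2.7: the Hecke field, integrality and conjugation of eigenforms,
# from the spanning statement (2.7.2)

D-0014 keeps `Literature/` sorry-free by stating cited results as named facts `def X : Prop`.
Deligne–Serre, *Formes modulaires de poids 1*, Prop. 2.7 (p. 512) reads: *Soit `L` l'ensemble
des `f ∈ S_ℂ` telles que `(f|R_d)_∞(q) ∈ ℤ[[q]]` pour tout `d ∈ (ℤ/Nℤ)^*`.  Alors : (2.7.1) `L`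
est un `ℤ`-module libre de type fini, stable par les `T_p` et `R_d`.  (2.7.2) Pour tout corps
`K ⊇ ℚ`, `S_K = K ⊗ L`.  (2.7.3) Les valeurs propres des `T_p` dans `S_ℂ` sont des entiers d'une
extension finie de `ℚ`.  (2.7.4) Si `f|T_p = a_p f`, alors pour tout automorphisme `σ` de `ℂ`,
`σ(f)|T_p = σ(a_p) σ(f)`; si `f` est de type `(k, ε)`, `σ(f)` est de type `(k, σ(ε))`.*

The tree has `L = integralLattice1 N k`, (2.7.1) proved (`integralLattice1_fg`,
`heckeT_mem_integralLattice1`, `diamondOp_mem_integralLattice1`) and (2.7.2) as the named fact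
`DeligneSerre1974_span_integralLattice1 N k : 1 ≤ k → span_ℂ L = ⊤`
(`Literature.NumberTheory.EllipticCurves.NewformGaloisRepIntegralityProofs`, which also derives
the integrality half of (2.7.3) and `IsNewform1.exists_map_eq_heckePolynomial`).  This file
derives **the rest of Prop. 2.7 from (2.7.2)**, discharging — conditionally on (2.7.2) alone —
three further named facts used by the weight-one theorem
(`DeligneSerreWeightOneAssembly.exists_complexGaloisRep_of_weight_one_of_facts'`):

* `IsNewform1.finiteDimensional_coeffField_of_span_integralLattice1` — the named fact
  `IsNewform1.finiteDimensional_coeffField` of `Newforms` (`K_f = ℚ(aₙ(f))` is a number field;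
  Shimura 1971, Thm. 3.48; Diamond–Shurman Thm. 6.5.1; (2.7.3) with §8.2);
* `DeligneSerre1974.prop27_eigenvalues_of_span_integralLattice1` — the named fact
  `DeligneSerre1974.prop27_eigenvalues` of `DeligneSerreRankinProofs` ((2.7.1)–(2.7.3));
* `DeligneSerre1974.prop27_conj_of_span_integralLattice1` — the named fact
  `DeligneSerre1974.prop27_conj` of `DeligneSerreRankinProofs` ((2.7.4), in the embedding form
  used in the proof of Prop. 5.5).

## The proofs (§1 is pure linear algebra, namespace `LatticeEigen`)

* **(2.7.3), number field.**  For a `ℤ`-lattice `L` of finite type spanning a complex vector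
  space `V` and `f ≠ 0`, the `ℤ`-algebra `eigenStabilizer L f` of operators preserving `L` with
  `f` as eigenvector embeds (restriction) into `End_ℤ(L)`, a finitely generated `ℤ`-module, so
  the image of its eigenvalue character `evRingHom` is a subring of `ℂ` finitely generated over
  `ℤ` (`exists_fg_subalgebra_ev`; Diamond–Shurman (6.12)).  It contains the `a_p` (and the
  `ε(d)`), whence `ℚ(a_p : p ∤ N)` and, for a newform, `ℚ(aₙ : n)` (all `aₙ ∈ ℤ[a_p, ε(d)]` by
  the Hecke recursions) are finite over `ℚ` (`finiteDimensional_of_le_adjoin_of_subset_fg_subalgebra`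
  of `NewformsCoeffFieldProofs`).  Integrality is `isIntegral_of_heckeT_gamma1_apply_eq_smul`.
* **(2.7.2), basis form.**  A `ℤ`-basis of `L` is a `ℂ`-basis of `S_k(Γ₁(N))`
  (`integralBasis`): it spans by (2.7.2), and it is `ℂ`-free because the coefficient functionals
  `aₙ` are rational on `L` and jointly injective (`linearIndependent_complex_of_rat_functionals`:
  apply `ℚ`-linear forms `ℂ → ℚ` to a complex relation).  In this basis the `T_p` and `⟨d⟩`
  have integer matrices.
* **(2.7.4).**  With integer matrices `A_T` and eigenvalues `λ_T` in a subfield `K₁`, a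
  `K₁`-linear form `π : ℂ → K₁` maps the coordinate vector of `f` to a non-zero solution
  `x ∈ K₁ⁿ` of `A_T x = λ_T x`, and `g = ∑ σ(xᵢ) bᵢ` solves `A_T g = σ(λ_T) g`
  (`exists_eigenvector_conj`).  Here `K₁ = ℚ(a_p, ε(d))` (algebraic), and the given
  `τ : K → ℂ` (with `a_p ∈ K`) is first restricted to `ℚ(a_p)` and then extended to `K₁`
  (`IntermediateField.exists_algHom_adjoin_of_splits`); `g` is of type `(k, σ ∘ ε)`.
  Deligne–Serre's `σ ∈ Aut(ℂ)` is thus replaced by an embedding of the Hecke field, which is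
  all that (2.7.4) is used for (proof of Prop. 5.5, p. 520).

Weights `k ≤ 0` are vacuous throughout (`cuspForm_eq_zero_of_weight_nonpos`).

## References

* P. Deligne, J.-P. Serre, *Formes modulaires de poids 1*, Ann. Sci. ÉNS (4) 7 (1974), 507–530,
  Prop. 2.7 (p. 512), §8.2.
* G. Shimura, *Introduction to the arithmetic theory of automorphic functions*, 1971, Thm. 3.48.
* F. Diamond, J. Shurman, *A first course in modular forms*, GTM 228, Springer 2005, §6.5
  (Thm. 6.5.1, (6.12), Def. 6.5.3), Prop. 5.8.5.
-/

noncomputable section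

open Module

namespace Literature.NumberTheory.EllipticCurves.ModularForms

/-! ## 1. Lattices with a rational structure in a complex vector space -/

namespace LatticeEigen

variable {V : Type*} [AddCommGroup V] [Module ℂ V]

/-! ### The eigen-stabiliser of a lattice and its eigenvalue character -/

/-- For a `ℤ`-submodule `L ⊆ V` and a vector `f`, the `ℤ`-subalgebra of `End_ℂ(V)` of the
operators `T` with `T(L) ⊆ L` of which `f` is an eigenvector (Deligne–Serre 1974, proof of
Prop. 2.7 / Diamond–Shurman §6.5: the Hecke ring acting on the lattice `L`). [folklore] -/
def eigenStabilizer (L : Submodule ℤ V) (f : V) : Subalgebra ℤ (Module.End ℂ V) where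
  carrier := {T | (∀ x ∈ L, T x ∈ L) ∧ ∃ c : ℂ, T f = c • f}
  mul_mem' := by
    rintro T T' ⟨hT, c, hc⟩ ⟨hT', c', hc'⟩
    refine ⟨fun x hx ↦ hT _ (hT' x hx), c' * c, ?_⟩
    rw [Module.End.mul_apply, hc', map_smul, hc, smul_smul]
  one_mem' := ⟨fun x hx ↦ by simpa using hx, 1, by simp⟩
  add_mem' := by
    rintro T T' ⟨hT, c, hc⟩ ⟨hT', c', hc'⟩
    refine ⟨fun x hx ↦ ?_, c + c', ?_⟩
    · rw [LinearMap.add_apply]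
      exact L.add_mem (hT x hx) (hT' x hx)
    · rw [LinearMap.add_apply, hc, hc', add_smul]
  zero_mem' := ⟨fun x _ ↦ by simp, 0, by simp⟩
  algebraMap_mem' n := by
    refine ⟨fun x hx ↦ ?_, n, ?_⟩
    · rw [eq_intCast, Module.End.intCast_apply]
      exact L.smul_mem n hx
    · rw [eq_intCast, Module.End.intCast_apply, Int.cast_smul_eq_zsmul]

variable {L : Submodule ℤ V} {f : V}

/-- Unfolding lemma for `eigenStabilizer`. [folklore] -/
lemma mem_eigenStabilizer {T : Module.End ℂ V} :
    T ∈ eigenStabilizer L f ↔ (∀ x ∈ L, T x ∈ L) ∧ ∃ c : ℂ, T f = c • f :=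
  Iff.rfl

/-- The eigenvalue of `T ∈ eigenStabilizer L f` on `f` (a choice; unique when `f ≠ 0`).
[folklore] -/
def ev (T : eigenStabilizer L f) : ℂ :=
  T.2.2.choose

/-- Defining property of `ev`. [folklore] -/
lemma apply_eq_ev_smul (T : eigenStabilizer L f) : T.1 f = ev T • f :=
  T.2.2.choose_spec

/-- Uniqueness of the eigenvalue of a non-zero eigenvector. [folklore] -/
lemma ev_eq_of_eq_smul (hf : f ≠ 0) {T : eigenStabilizer L f} {c : ℂ} (h : T.1 f = c • f) :
    ev T = c :=
  smul_left_injective ℂ hf ((apply_eq_ev_smul T).symm.trans h)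

/-- The **eigenvalue character** `T ↦ λ_f(T)` of the eigen-stabiliser on a non-zero common
eigenvector `f`, as a ring homomorphism (Diamond–Shurman §6.5, (6.12)). [folklore] -/
def evRingHom (hf : f ≠ 0) : eigenStabilizer L f →+* ℂ where
  toFun := ev
  map_one' := ev_eq_of_eq_smul hf (by simp)
  map_mul' T T' := ev_eq_of_eq_smul hf <| by
    change T.1 (T'.1 f) = _
    rw [apply_eq_ev_smul T', map_smul, apply_eq_ev_smul T, smul_smul, mul_comm]
  map_zero' := ev_eq_of_eq_smul hf (by simp)
  map_add' T T' := ev_eq_of_eq_smul hf <| by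
    change T.1 f + T'.1 f = _
    rw [apply_eq_ev_smul T, apply_eq_ev_smul T', add_smul]

/-- `evRingHom` is `ev`. [folklore] -/
@[simp] lemma evRingHom_apply (hf : f ≠ 0) (T : eigenStabilizer L f) : evRingHom hf T = ev T :=
  rfl

variable (L f) in
/-- **The eigen-stabiliser of a spanning lattice of finite type is a finitely generated
`ℤ`-module**: restriction to `L` embeds it into `End_ℤ(L)` (injective because `L` spans `V`
over `ℂ`), a finitely generated `ℤ`-module as `L` is free of finite rank (Deligne–Serre 1974,
proof of (2.7.3); Shimura 1971, proof of Thm. 3.48; Diamond–Shurman §6.5). [folklore] -/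
theorem finite_eigenStabilizer [Module.Finite ℤ L] [Module.Free ℤ L]
    (hspan : Submodule.span ℂ (L : Set V) = ⊤) : Module.Finite ℤ (eigenStabilizer L f) := by
  let res : eigenStabilizer L f →ₗ[ℤ] (L →ₗ[ℤ] L) :=
    { toFun := fun T ↦ (T.1.restrictScalars ℤ).restrict fun x hx ↦ T.2.1 x hx
      map_add' := fun T T' ↦ by ext; rfl
      map_smul' := fun n T ↦ by ext; rfl }
  refine Module.Finite.of_injective res fun T T' h ↦ ?_
  apply Subtype.ext
  refine LinearMap.ext_on hspan fun x hx ↦ ?_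
  have := congrArg (fun g : L →ₗ[ℤ] L ↦ (g ⟨x, hx⟩ : V)) h
  simpa [res] using this

variable (L) in
/-- **The eigenvalues of a common eigenvector of lattice-preserving operators lie in a subring
of `ℂ` which is a finitely generated `ℤ`-module** (hence in an order of a number field): the
image of the eigenvalue character of the eigen-stabiliser.  This is the argument of
Deligne–Serre 1974, (2.7.3) ("les valeurs propres des `T_p` … sont des entiers d'une extension
finie de `ℚ`") and of Diamond–Shurman §6.5, (6.12). [cite: DeligneSerreASENS1974, Prop. 2.7 (2.7.3), proof] -/
theorem exists_fg_subalgebra_ev (hL : L.FG) (hspan : Submodule.span ℂ (L : Set V) = ⊤)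
    (hf : f ≠ 0) :
    ∃ K : Subalgebra ℤ ℂ, (Subalgebra.toSubmodule K).FG ∧
      ∀ (T : Module.End ℂ V) (c : ℂ), (∀ x ∈ L, T x ∈ L) → T f = c • f → c ∈ K := by
  haveI : IsAddTorsionFree V := IsAddTorsionFree.of_isTorsionFree ℂ V
  haveI : Module.Finite ℤ L := Module.Finite.iff_fg.mpr hL
  haveI := finite_eigenStabilizer L f hspan
  refine ⟨(evRingHom (L := L) hf).toIntAlgHom.range, ?_, fun T c hT hc ↦ ?_⟩
  · have hsurj : Function.Surjective (evRingHom (L := L) hf).toIntAlgHom.rangeRestrict := by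
      rintro ⟨y, x, rfl⟩
      exact ⟨x, rfl⟩
    have : Module.Finite ℤ (evRingHom (L := L) hf).toIntAlgHom.range :=
      Module.Finite.of_surjective (evRingHom (L := L) hf).toIntAlgHom.rangeRestrict.toLinearMap hsurj
    exact Module.Finite.iff_fg.mp this
  · exact ⟨⟨T, hT, c, hc⟩, ev_eq_of_eq_smul hf hc⟩

/-- The eigenvalue of an operator `T` on a vector `f`, if `f` is an eigenvector of `T` (and the
junk value `0` otherwise). [folklore] -/
def eigenvalueOf (f : V) (T : Module.End ℂ V) : ℂ := by
  classical
  exact if h : ∃ c : ℂ, T f = c • f then h.choose else 0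

/-- Defining property of `eigenvalueOf`. [folklore] -/
lemma apply_eq_eigenvalueOf_smul {T : Module.End ℂ V} (h : ∃ c : ℂ, T f = c • f) :
    T f = eigenvalueOf f T • f := by
  classical
  rw [eigenvalueOf, dif_pos h]
  exact h.choose_spec

/-- `eigenvalueOf f T` is the eigenvalue when `f ≠ 0`. [folklore] -/
lemma eigenvalueOf_eq (hf : f ≠ 0) {T : Module.End ℂ V} {c : ℂ} (h : T f = c • f) :
    eigenvalueOf f T = c :=
  smul_left_injective ℂ hf ((apply_eq_eigenvalueOf_smul ⟨c, h⟩).symm.trans h)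

/-! ### A `ℤ`-basis of a lattice with a rational structure is a `ℂ`-basis -/

/-- **Linear disjointness.** Let `v` be a `ℤ`-linearly independent family in a complex vector
space `V` carrying a family of `ℂ`-linear functionals `φ a` which take rational values on the
`v i` and jointly separate the points of `V`.  Then `v` is `ℂ`-linearly independent.  (If
`∑ gᵢ vᵢ = 0`, apply a `ℚ`-linear `π : ℂ → ℚ` to the rational relations `∑ gᵢ φ_a(vᵢ) = 0`:
the rational vector `∑ π(gᵢ) vᵢ` is killed by every `φ_a`, hence vanishes, hence `π(gᵢ) = 0`
for all `π`.)  This is how Deligne–Serre's "les formes linéaires « n-ièmes coefficients »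
séparent `S_ℂ`" yields the injectivity in `S_ℂ = ℂ ⊗ L` (op. cit. (2.7.2)). [folklore] -/
theorem linearIndependent_complex_of_rat_functionals {ι : Type*} {v : ι → V}
    (hv : LinearIndependent ℤ v) {α : Type*} (φ : α → V →ₗ[ℂ] ℂ)
    (hφv : ∀ a i, ∃ q : ℚ, φ a (v i) = q) (hφ : ∀ w : V, (∀ a, φ a w = 0) → w = 0) :
    LinearIndependent ℂ v := by
  classical
  letI : Module ℚ V := Module.compHom V (algebraMap ℚ ℂ)
  haveI : IsScalarTower ℚ ℂ V := IsScalarTower.of_algebraMap_smul fun _ _ ↦ rfl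
  have hvQ : LinearIndependent ℚ v := (LinearIndependent.iff_fractionRing ℤ ℚ).mp hv
  rw [linearIndependent_iff'] at hvQ ⊢
  intro s g hsum i₀ hi₀
  by_contra hne
  obtain ⟨π, hπ⟩ := Module.Projective.exists_dual_ne_zero ℚ hne
  choose q hq using hφv
  -- the rational vector `w = ∑ π(gᵢ) vᵢ` is killed by all `φ a`
  have hw : ∀ a, φ a (∑ i ∈ s, π (g i) • v i) = 0 := by
    intro a
    have h1 : ∑ i ∈ s, g i * (q a i : ℂ) = 0 := by
      have := congrArg (φ a) hsum
      simpa [map_sum, map_smul, hq] using this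
    have h2 : ∑ i ∈ s, q a i * π (g i) = 0 := by
      have := congrArg π h1
      rw [map_sum, map_zero] at this
      rw [← this]
      refine Finset.sum_congr rfl fun i _ ↦ ?_
      rw [mul_comm (g i), ← Rat.smul_def, map_smul, smul_eq_mul]
    calc φ a (∑ i ∈ s, π (g i) • v i) = ∑ i ∈ s, ((π (g i) * q a i : ℚ) : ℂ) := by
          rw [map_sum]
          refine Finset.sum_congr rfl fun i _ ↦ ?_
          rw [LinearMap.map_smul_of_tower, hq, Rat.smul_def, Rat.cast_mul]
      _ = 0 := by
          rw [← Rat.cast_sum, show ∑ i ∈ s, π (g i) * q a i = 0 by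
            simpa only [mul_comm] using h2, Rat.cast_zero]
  have hw0 := hφ _ hw
  exact hπ (hvQ s (fun i ↦ π (g i)) hw0 i₀ hi₀)

section Basis

variable (L) [Module.Finite ℤ L] [Module.Free ℤ L]

/-- A `ℤ`-basis of the (free, finitely generated) lattice `L`, as a family of vectors of `V`.
[folklore] -/
def latticeVec (i : Module.Free.ChooseBasisIndex ℤ L) : V :=
  (Module.Free.chooseBasis ℤ L i : L)

omit [Module ℂ V] [Module.Finite ℤ L] in
/-- The vectors `latticeVec L i` lie in `L`. [folklore] -/
lemma latticeVec_mem (i : Module.Free.ChooseBasisIndex ℤ L) : latticeVec L i ∈ L :=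
  (Module.Free.chooseBasis ℤ L i).2

omit [Module ℂ V] [Module.Finite ℤ L] in
/-- The `ℤ`-basis of `L` is `ℤ`-linearly independent in `V`. [folklore] -/
lemma linearIndependent_int_latticeVec : LinearIndependent ℤ (latticeVec L) :=
  (Module.Free.chooseBasis ℤ L).linearIndependent.map' L.subtype (Submodule.ker_subtype L)

/-- Every `x ∈ L` is the integer combination `∑ nᵢ • latticeVec L i` given by its coordinates
in the `ℤ`-basis. [folklore] -/
lemma sum_repr_smul_latticeVec {x : V} (hx : x ∈ L) :
    ∑ i, ((Module.Free.chooseBasis ℤ L).repr ⟨x, hx⟩ i : ℂ) • latticeVec L i = x := by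
  have h := congrArg (L.subtype : L → V) ((Module.Free.chooseBasis ℤ L).sum_repr ⟨x, hx⟩)
  rw [map_sum] at h
  simp only [Submodule.subtype_apply, Submodule.coe_smul_of_tower] at h
  simp only [Int.cast_smul_eq_zsmul]
  exact h

variable {α : Type*} (φ : α → V →ₗ[ℂ] ℂ)

/-- **`S_ℂ = ℂ ⊗ L` (Deligne–Serre 1974, (2.7.2)), basis form.**  If the finitely generated
lattice `L` spans `V` over `ℂ` and `V` carries jointly injective `ℂ`-linear functionals with
rational values on `L`, then a `ℤ`-basis of `L` is a `ℂ`-basis of `V`. [cite: DeligneSerreASENS1974, Prop. 2.7 (2.7.2)] -/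
def latticeBasis (hspan : Submodule.span ℂ (L : Set V) = ⊤)
    (hφL : ∀ a, ∀ x ∈ L, ∃ q : ℚ, φ a x = q) (hφ : ∀ w : V, (∀ a, φ a w = 0) → w = 0) :
    Basis (Module.Free.ChooseBasisIndex ℤ L) ℂ V :=
  Basis.mk (linearIndependent_complex_of_rat_functionals (linearIndependent_int_latticeVec L) φ
    (fun a i ↦ hφL a _ (latticeVec_mem L i)) hφ) <| by
    rw [← hspan, Submodule.span_le]
    intro x hx
    rw [SetLike.mem_coe, ← sum_repr_smul_latticeVec L hx]
    exact Submodule.sum_mem _ fun i _ ↦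
      Submodule.smul_mem _ _ (Submodule.subset_span (Set.mem_range_self i))

variable {hspan : Submodule.span ℂ (L : Set V) = ⊤}
  {hφL : ∀ a, ∀ x ∈ L, ∃ q : ℚ, φ a x = q} {hφ : ∀ w : V, (∀ a, φ a w = 0) → w = 0}

/-- `latticeBasis` is the `ℤ`-basis of `L`. [folklore] -/
@[simp] lemma latticeBasis_apply (i : Module.Free.ChooseBasisIndex ℤ L) :
    latticeBasis L φ hspan hφL hφ i = latticeVec L i :=
  Basis.mk_apply _ _ i

/-- Elements of `L` have integer coordinates in `latticeBasis`. [folklore] -/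
lemma exists_int_repr_latticeBasis {x : V} (hx : x ∈ L) (i : Module.Free.ChooseBasisIndex ℤ L) :
    ∃ n : ℤ, (latticeBasis L φ hspan hφL hφ).repr x i = n := by
  refine ⟨(Module.Free.chooseBasis ℤ L).repr ⟨x, hx⟩ i, ?_⟩
  conv_lhs => rw [← sum_repr_smul_latticeVec L hx]
  simp only [map_sum, map_smul, Finsupp.coe_finsetSum, Finset.sum_apply, Finsupp.coe_smul,
    Pi.smul_apply, smul_eq_mul]
  rw [Finset.sum_eq_single i]
  · rw [← latticeBasis_apply L φ (hspan := hspan) (hφL := hφL) (hφ := hφ) i, Basis.repr_self,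
      Finsupp.single_eq_same, mul_one]
  · intro j _ hji
    rw [← latticeBasis_apply L φ (hspan := hspan) (hφL := hφL) (hφ := hφ) j, Basis.repr_self,
      Finsupp.single_eq_of_ne hji.symm, mul_zero]
  · exact fun h ↦ absurd (Finset.mem_univ i) h

/-- **Lattice-preserving operators have integer matrices** in `latticeBasis`. [folklore] -/
lemma exists_int_repr_latticeBasis_apply (T : Module.End ℂ V) (hT : ∀ x ∈ L, T x ∈ L)
    (i j : Module.Free.ChooseBasisIndex ℤ L) :
    ∃ n : ℤ, (latticeBasis L φ hspan hφL hφ).repr (T (latticeBasis L φ hspan hφL hφ j)) i = n := by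
  refine exists_int_repr_latticeBasis L φ (hT _ ?_) i
  rw [latticeBasis_apply]
  exact latticeVec_mem L j

end Basis

/-! ### Transport of common eigenvectors along a field embedding -/

section Conj

variable {ι : Type*} [Fintype ι]

/-- Coordinates of `T y` for `y` given by coordinates: `(T(∑ yᵢ bᵢ))_l = ∑ᵢ yᵢ (T bᵢ)_l`.
[folklore] -/
lemma equivFun_apply_equivFun_symm (b : Basis ι ℂ V) (T : Module.End ℂ V) (y : ι → ℂ) (l : ι) :
    b.equivFun (T (b.equivFun.symm y)) l = ∑ i, y i * b.repr (T (b i)) l := by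
  rw [Basis.equivFun_symm_apply, map_sum, Basis.equivFun_apply, map_sum, Finsupp.coe_finsetSum,
    Finset.sum_apply]
  refine Finset.sum_congr rfl fun i _ ↦ ?_
  rw [map_smul, map_smul, Finsupp.coe_smul, Pi.smul_apply, smul_eq_mul]

/-- **Conjugates of common eigenvectors** (the linear algebra of Deligne–Serre 1974, (2.7.4):
"pour tout automorphisme `σ` de `ℂ`, la forme `σ(f)` est telle que `σ(f)|T_p = σ(a_p) σ(f)`").
Let `b` be a `ℂ`-basis of `V` in which every operator of a family `𝒯` has a rational matrix,
`f ≠ 0` a common eigenvector of `𝒯` with eigenvalues `λ_T` in a subfield `K ⊆ ℂ`, and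
`σ : K → ℂ` a field embedding.  Then there is `g ≠ 0` with `T g = σ(λ_T) g` for all `T ∈ 𝒯`.
(Proof: a `K`-linear `π : ℂ → K` non-zero on some coordinate of `f` maps the coordinate vector
of `f` to a solution `x ∈ Kⁿ` of the `K`-linear eigen-equations; `g = ∑ σ(xᵢ) bᵢ`.) [cite: DeligneSerreASENS1974, Prop. 2.7 (2.7.4)] -/
theorem exists_eigenvector_conj (b : Basis ι ℂ V) (𝒯 : Set (Module.End ℂ V))
    (hrat : ∀ T ∈ 𝒯, ∀ i j, ∃ q : ℚ, b.repr (T (b j)) i = q)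
    (K : IntermediateField ℚ ℂ) (σ : K →+* ℂ) {f : V} (hf : f ≠ 0)
    (lam : Module.End ℂ V → ℂ) (hlam : ∀ T ∈ 𝒯, lam T ∈ K) (heig : ∀ T ∈ 𝒯, T f = lam T • f) :
    ∃ g : V, g ≠ 0 ∧ ∀ T (hT : T ∈ 𝒯), T g = σ ⟨lam T, hlam T hT⟩ • g := by
  classical
  set c : ι → ℂ := b.equivFun f with hc
  have hfc : f = b.equivFun.symm c := (b.equivFun.symm_apply_apply f).symm
  obtain ⟨i₀, hi₀⟩ : ∃ i, c i ≠ 0 := by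
    by_contra h
    exact hf (by rw [hfc, show c = 0 from funext fun i ↦ not_not.mp (not_exists.mp h i), map_zero])
  obtain ⟨π, hπ⟩ := Module.Projective.exists_dual_ne_zero K hi₀
  -- rational matrices
  choose q hq using hrat
  -- (E1) the eigen-equations in coordinates
  have E1 : ∀ T (hT : T ∈ 𝒯) (l : ι), ∑ i, c i * (q T hT l i : ℂ) = lam T * c l := by
    intro T hT l
    have h : b.equivFun (T f) l = b.equivFun (lam T • f) l := by rw [heig T hT]
    rw [map_smul, Pi.smul_apply, smul_eq_mul, ← hc] at h
    rw [← h, hfc, equivFun_apply_equivFun_symm]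
    exact Finset.sum_congr rfl fun i _ ↦ by rw [hq T hT l i]
  -- (E2) apply `π`
  set x : ι → K := fun i ↦ π (c i) with hx
  have E2 : ∀ T (hT : T ∈ 𝒯) (l : ι),
      ∑ i, (q T hT l i : K) * x i = ⟨lam T, hlam T hT⟩ * x l := by
    intro T hT l
    have h := congrArg π (E1 T hT l)
    rw [map_sum] at h
    have h1 : ∀ i, π (c i * (q T hT l i : ℂ)) = (q T hT l i : K) * x i := by
      intro i
      rw [mul_comm, show ((q T hT l i : ℂ)) * c i = (q T hT l i : K) • c i by
        rw [IntermediateField.smul_def]; norm_cast, map_smul, smul_eq_mul]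
    have h2 : π (lam T * c l) = ⟨lam T, hlam T hT⟩ * x l := by
      rw [show lam T * c l = (⟨lam T, hlam T hT⟩ : K) • c l from rfl, map_smul, smul_eq_mul]
    simpa only [h1, h2] using h
  -- (E3) apply `σ`
  have E3 : ∀ T (hT : T ∈ 𝒯) (l : ι),
      ∑ i, σ (x i) * (q T hT l i : ℂ) = σ ⟨lam T, hlam T hT⟩ * σ (x l) := by
    intro T hT l
    have h := congrArg σ (E2 T hT l)
    rw [map_sum, map_mul] at h
    rw [← h]
    refine Finset.sum_congr rfl fun i _ ↦ ?_
    rw [map_mul, map_ratCast, mul_comm]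
  refine ⟨b.equivFun.symm fun i ↦ σ (x i), ?_, fun T hT ↦ ?_⟩
  · intro h0
    have := congrArg (fun v ↦ b.equivFun v i₀) h0
    simp only [LinearEquiv.apply_symm_apply, map_zero, Pi.zero_apply,
      map_eq_zero_iff σ σ.injective] at this
    exact hπ this
  · apply b.equivFun.injective
    funext l
    rw [equivFun_apply_equivFun_symm, map_smul, LinearEquiv.apply_symm_apply, Pi.smul_apply,
      smul_eq_mul, ← E3 T hT l]
    exact Finset.sum_congr rfl fun i _ ↦ by rw [hq T hT l i]

end Conj

end LatticeEigen

/-! ## 2. Deligne–Serre's lattice in `S_k(Γ₁(N))`: rational structure and eigenvalues -/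

section ModularForms

open scoped MatrixGroups
open CongruenceSubgroup UpperHalfPlane

variable {N : ℕ} [NeZero N] {k : ℤ}

/-- A `Γ₁(N)`-cusp form all of whose Fourier coefficients vanish is zero (`q`-expansion,
`hasSum_qExpansion_Gamma1`): Deligne–Serre's "les formes linéaires « n-ièmes coefficients »
séparent les éléments de `S_ℂ`" (proof of Prop. 2.7). [folklore] -/
theorem cuspForm_gamma1_eq_zero_of_forall_cuspCoeff (f : CuspForm (Gamma1 N) k)
    (h : ∀ n, cuspCoeff f n = 0) : f = 0 := by
  ext τ
  have hs := HeckeTGamma1.hasSum_qExpansion_Gamma1 N k f τ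
  simp only [show ∀ n, (qExpansion 1 ⇑f).coeff n = 0 from h, zero_smul] at hs
  simpa using hs.unique hasSum_zero

/-- On Deligne–Serre's lattice `L` the coefficient functionals take rational (indeed integral)
values. [cite: DeligneSerreASENS1974, Prop. 2.7] -/
theorem exists_rat_cuspCoeffₗ_of_mem_integralLattice1 (n : ℕ) {x : CuspForm (Gamma1 N) k}
    (hx : x ∈ integralLattice1 N k) :
    ∃ q : ℚ, cuspCoeffₗ (HeckeTGamma1.one_mem_strictPeriods_Gamma1 N) n x = q := by
  obtain ⟨z, hz⟩ := exists_int_eq_cuspCoeff_of_mem_integralLattice1 hx n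
  exact ⟨z, by rw [cuspCoeffₗ_apply, ← hz, Rat.cast_intCast]⟩

/-- `S_k(Γ₁(N))` is torsion-free as an additive group (a complex vector space). [folklore] -/
instance : IsAddTorsionFree (CuspForm (Gamma1 N) k) := IsAddTorsionFree.of_isTorsionFree ℂ _

/-- Deligne–Serre's lattice `L` is a finitely generated `ℤ`-module (`integralLattice1_fg`,
(2.7.1)); hence (torsion-free over the PID `ℤ`) free of finite rank. [cite: DeligneSerreASENS1974, Prop. 2.7 (2.7.1)] -/
instance : Module.Finite ℤ (integralLattice1 N k) :=
  Module.Finite.iff_fg.mpr (integralLattice1_fg N k)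

variable (N k) in
/-- **Deligne–Serre 1974, (2.7.2), basis form: granted `span_ℂ L = S_k(Γ₁(N))`, a `ℤ`-basis of
`L` is a `ℂ`-basis of `S_k(Γ₁(N))`** (the injectivity `ℂ ⊗ L ↪ S_ℂ` being proved from the
rationality of the coefficient functionals on `L`, `LatticeEigen.latticeBasis`). [cite: DeligneSerreASENS1974, Prop. 2.7 (2.7.2)] -/
def integralBasis (hspan : Submodule.span ℂ (integralLattice1 N k : Set (CuspForm (Gamma1 N) k)) = ⊤) :
    Basis (Module.Free.ChooseBasisIndex ℤ (integralLattice1 N k)) ℂ (CuspForm (Gamma1 N) k) :=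
  LatticeEigen.latticeBasis (integralLattice1 N k)
    (fun n ↦ cuspCoeffₗ (HeckeTGamma1.one_mem_strictPeriods_Gamma1 N) n) hspan
    (fun n _ hx ↦ exists_rat_cuspCoeffₗ_of_mem_integralLattice1 n hx)
    cuspForm_gamma1_eq_zero_of_forall_cuspCoeff

/-- Operators preserving `L` have integer matrices in `integralBasis`. [folklore] -/
theorem exists_int_repr_integralBasis
    (hspan : Submodule.span ℂ (integralLattice1 N k : Set (CuspForm (Gamma1 N) k)) = ⊤)
    (T : Module.End ℂ (CuspForm (Gamma1 N) k))
    (hT : ∀ x ∈ integralLattice1 N k, T x ∈ integralLattice1 N k)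
    (i j : Module.Free.ChooseBasisIndex ℤ (integralLattice1 N k)) :
    ∃ n : ℤ, (integralBasis N k hspan).repr (T (integralBasis N k hspan j)) i = n :=
  LatticeEigen.exists_int_repr_latticeBasis_apply _ _ T hT i j

/-- Membership in `S_k(N, χ)`: `f ∈ nebentypusSubspace N k χ` iff `⟨d⟩ f = χ(d) f` for all
units `d`. [folklore] -/
theorem mem_nebentypusSubspace_iff_diamondOp {χ : DirichletCharacter ℂ N}
    {f : CuspForm (Gamma1 N) k} :
    f ∈ nebentypusSubspace N k χ ↔
      ∀ d : (ZMod N)ˣ, diamondOp N k (d : ZMod N) f = χ (d : ZMod N) • f := by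
  simp only [nebentypusSubspace, Submodule.mem_iInf, LinearMap.mem_ker, LinearMap.sub_apply,
    LinearMap.smul_apply, LinearMap.id_apply, sub_eq_zero]

/-- **The eigenvalues of a common eigenvector of `L`-preserving operators on `S_k(Γ₁(N))`,
`k ≥ 1`, lie in a subring of `ℂ` finitely generated as a `ℤ`-module**, granted (2.7.2)
(Deligne–Serre 1974, (2.7.3) and its proof). [cite: DeligneSerreASENS1974, Prop. 2.7 (2.7.3)] -/
theorem exists_fg_subalgebra_of_span_integralLattice1 (hL : DeligneSerre1974_span_integralLattice1 N k)
    (hk : 1 ≤ k) {f : CuspForm (Gamma1 N) k} (hf : f ≠ 0) :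
    ∃ K : Subalgebra ℤ ℂ, (Subalgebra.toSubmodule K).FG ∧
      ∀ (T : Module.End ℂ (CuspForm (Gamma1 N) k)) (c : ℂ),
        (∀ x ∈ integralLattice1 N k, T x ∈ integralLattice1 N k) → T f = c • f → c ∈ K :=
  LatticeEigen.exists_fg_subalgebra_ev _ (integralLattice1_fg N k) (hL hk) hf

/-! ## 3. The coefficient field of a newform on `Γ₁(N)` is a number field -/

/-- For a newform `f ∈ S_k(Γ₁(N))`, granted (2.7.2), **all Fourier coefficients `aₙ(f)` lie in
one subring of `ℂ` finitely generated as a `ℤ`-module**: the image of the eigenvalue character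
contains `a_p` (`T_p f = a_p f`, `IsNewform1.heckeEigenvalue_eq_coeff_holds`) and `ε(d)`
(`⟨d⟩ f = ε(d) f`, `IsNewform1.mem_nebentypusSubspace_nebentypus_holds`), hence `ε(p) p^{k-1}`,
and then every `aₙ` by the Hecke recursions `IsNewform1.cuspCoeff_prime_pow_add_two_holds`,
`IsNewform1.cuspCoeff_mul_of_coprime_holds` (Diamond–Shurman Prop. 5.8.5; §6.5, (6.12)). [cite: DeligneSerreASENS1974, Prop. 2.7 (2.7.3)] -/
theorem IsNewform1.exists_fg_subalgebra_cuspCoeff_mem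
    (hL : DeligneSerre1974_span_integralLattice1 N k) {f : CuspForm (Gamma1 N) k}
    (hf : IsNewform1 f) :
    ∃ K : Subalgebra ℤ ℂ, (Subalgebra.toSubmodule K).FG ∧ ∀ n, cuspCoeff f n ∈ K := by
  rcases le_or_gt k 0 with hk | hk
  · exact absurd (cuspForm_eq_zero_of_weight_nonpos hk f) hf.ne_zero
  have hk1 : (1 : ℤ) ≤ k := hk
  obtain ⟨K, hKfg, hK⟩ := exists_fg_subalgebra_of_span_integralLattice1 hL hk1 hf.ne_zero
  refine ⟨K, hKfg, ?_⟩
  -- `a_p ∈ K`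
  have hp1 : ∀ {p : ℕ}, p.Prime → cuspCoeff f p ∈ K := by
    intro p hp
    haveI : NeZero p := ⟨hp.ne_zero⟩
    have heig := heckeT_eq_heckeEigenvalue_smul f p (hf.2.1 p hp)
    rw [IsNewform1.heckeEigenvalue_eq_coeff_holds hf hp] at heig
    exact hK _ _ (fun x hx ↦ heckeT_mem_integralLattice1 hk1 hx p hp) heig
  -- `ε(p) p^{k-1} ∈ K`
  have hε : ∀ p : ℕ, (nebentypus f (p : ZMod N) : ℂ) * (p : ℂ) ^ (k - 1) ∈ K := by
    intro p
    obtain ⟨m, hm⟩ : ∃ m : ℕ, k - 1 = m := ⟨(k - 1).toNat, (Int.toNat_of_nonneg (by omega)).symm⟩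
    rw [hm, zpow_natCast]
    refine K.mul_mem ?_ (K.pow_mem (natCast_mem K p) m)
    by_cases hu : IsUnit (p : ZMod N)
    · obtain ⟨u, hu⟩ := hu
      rw [← hu]
      exact hK _ _ (fun x hx ↦ diamondOp_mem_integralLattice1 hx u)
        (mem_nebentypusSubspace_iff_diamondOp.mp
          (IsNewform1.mem_nebentypusSubspace_nebentypus_holds hf) u)
    · rw [MulChar.map_nonunit _ hu]
      exact K.zero_mem
  -- prime powers
  have hpow : ∀ {p : ℕ}, p.Prime → ∀ r : ℕ, cuspCoeff f (p ^ r) ∈ K := by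
    intro p hp r
    have key : ∀ r : ℕ, cuspCoeff f (p ^ r) ∈ K ∧ cuspCoeff f (p ^ (r + 1)) ∈ K := by
      intro r
      induction r with
      | zero =>
        refine ⟨?_, by simpa using hp1 hp⟩
        rw [pow_zero, show cuspCoeff f 1 = 1 from hf.2.2.2]
        exact K.one_mem
      | succ r ih =>
        refine ⟨ih.2, ?_⟩
        rw [show r + 1 + 1 = r + 2 from rfl, IsNewform1.cuspCoeff_prime_pow_add_two_holds hf hp r]
        exact K.sub_mem (K.mul_mem (hp1 hp) ih.2) (K.mul_mem (hε p) ih.1)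
    exact (key r).1
  intro n
  induction n using Nat.recOnPosPrimePosCoprime with
  | zero =>
    rw [show cuspCoeff f 0 = 0 from
      CuspFormClass.qExpansion_coeff_zero f one_pos (HeckeTGamma1.one_mem_strictPeriods_Gamma1 N)]
    exact K.zero_mem
  | one =>
    rw [show cuspCoeff f 1 = 1 from hf.2.2.2]
    exact K.one_mem
  | prime_pow p r hp hr => exact hpow hp r
  | coprime a b ha hb hab iha ihb =>
    rw [IsNewform1.cuspCoeff_mul_of_coprime_holds hf hab]
    exact K.mul_mem iha ihb

/-- **The coefficient field `K_f = ℚ(aₙ(f) : n)` of a newform `f ∈ S_k(Γ₁(N))` is a number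
field**, granted Deligne–Serre 1974, (2.7.2) (the named fact
`IsNewform1.finiteDimensional_coeffField` of `Newforms`; Shimura 1971, Thm. 3.48; Diamond–Shurman
Thm. 6.5.1, Def. 6.5.3; Deligne–Serre 1974, (2.7.3) with §8.2): all `aₙ` lie in a subring
`K ⊆ ℂ` finitely generated over `ℤ` (`IsNewform1.exists_fg_subalgebra_cuspCoeff_mem`), whose
elements are integral, so `ℚ(aₙ : n) ⊆ ℚ(K)` is finite over `ℚ`
(`finiteDimensional_of_le_adjoin_of_subset_fg_subalgebra`).  Once (2.7.2) is discharged,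
`finiteDimensional_coeffField_holds` is this theorem applied to its `_holds`. [cite: DeligneSerreASENS1974, Prop. 2.7 (2.7.3)] -/
theorem IsNewform1.finiteDimensional_coeffField_of_span_integralLattice1
    (hL : DeligneSerre1974_span_integralLattice1 N k) :
    IsNewform1.finiteDimensional_coeffField (N := N) (k := k) := by
  intro f hf
  obtain ⟨K, hKfg, hK⟩ := hf.exists_fg_subalgebra_cuspCoeff_mem hL
  exact finiteDimensional_of_le_adjoin_of_subset_fg_subalgebra K hKfg
    (T := Set.range fun n : ℕ ↦ (qExpansion 1 ⇑f).coeff n) (by rintro _ ⟨n, rfl⟩; exact hK n)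
    (coeffField f) le_rfl

end ModularForms

/-! ## 4. Deligne–Serre 1974, Prop. 2.7, (2.7.3) and (2.7.4), from (2.7.2) -/

namespace DeligneSerre1974

open scoped MatrixGroups
open CongruenceSubgroup UpperHalfPlane

/-- **Deligne–Serre 1974, Prop. 2.7, (2.7.1)–(2.7.3), from (2.7.2)** (the named fact
`prop27_eigenvalues` of `DeligneSerreRankinProofs`): for a non-zero cusp form `f` of type
`(k, ε)` on `Γ₀(N)` which is an eigenfunction of the `T_p`, `p ∤ N`, the eigenvalues `a_p`
are algebraic integers (`isIntegral_of_heckeT_gamma1_apply_eq_smul`, (2.7.3) via Cayley–Hamilton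
on `L`) lying in a finite extension of `ℚ` — namely `ℚ(a_p : p ∤ N)`, finite because all `a_p`
lie in the finitely generated image of the eigenvalue character of the Hecke ring acting on `L`
(`exists_fg_subalgebra_of_span_integralLattice1`).  Weight `k ≤ 0` is vacuous
(`cuspForm_eq_zero_of_weight_nonpos`). [cite: DeligneSerreASENS1974, Prop. 2.7 (2.7.1)–(2.7.3)] -/
theorem prop27_eigenvalues_of_span_integralLattice1
    (hL : ∀ (N : ℕ) [NeZero N] (k : ℤ), DeligneSerre1974_span_integralLattice1 N k) :
    prop27_eigenvalues := by
  intro N _ k ε f hfε hf0 heig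
  rcases le_or_gt k 0 with hk | hk
  · exact absurd (cuspForm_eq_zero_of_weight_nonpos hk f) hf0
  have hk1 : (1 : ℤ) ≤ k := hk
  obtain ⟨K', hK'fg, hK'⟩ := exists_fg_subalgebra_of_span_integralLattice1 (hL N k) hk1 hf0
  set S : Set ℂ := {a | ∃ p : ℕ, p.Prime ∧ ¬ p ∣ N ∧ a = heckeEigenvalue f p} with hS
  have hSK' : S ⊆ K' := by
    rintro _ ⟨p, hp, hpN, rfl⟩
    haveI : NeZero p := ⟨hp.ne_zero⟩
    exact hK' _ _ (fun x hx ↦ heckeT_mem_integralLattice1 hk1 hx p hp)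
      (heckeT_eq_heckeEigenvalue_smul f p (heig p hp hpN))
  refine ⟨IntermediateField.adjoin ℚ S,
    finiteDimensional_of_le_adjoin_of_subset_fg_subalgebra K' hK'fg hSK' _ le_rfl,
    fun p hp hpN ↦ ⟨IntermediateField.subset_adjoin ℚ S ⟨p, hp, hpN, rfl⟩, ?_⟩⟩
  haveI : NeZero p := ⟨hp.ne_zero⟩
  exact isIntegral_of_heckeT_gamma1_apply_eq_smul (hL N k) hk1 hp hf0
    (heckeT_eq_heckeEigenvalue_smul f p (heig p hp hpN))

/-- **Deligne–Serre 1974, Prop. 2.7, (2.7.4) (conjugates of eigenforms), from (2.7.2)** (the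
named fact `prop27_conj` of `DeligneSerreRankinProofs`).  Let `f ≠ 0` be of type `(k, ε)` on
`Γ₀(N)` with `T_p f = a_p f` (`p ∤ N`), `K ⊆ ℂ` a subfield containing the `a_p` and
`τ : K → ℂ` an embedding.  Then there are a character `ε'` and a cusp form `g ≠ 0` of type
`(k, ε')` with `T_p g = τ(a_p) g` for all `p ∤ N`.  Proof: extend `τ|ℚ(a_p)` to an embedding
`σ` of the number field `ℚ(a_p, ε(d))` generated by all eigenvalues of `f` under the
family `𝒯 = {T_p}_{p ∤ N} ∪ {⟨d⟩}` (`IntermediateField.exists_algHom_adjoin_of_splits`; the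
eigenvalues are algebraic integers); in the `ℂ`-basis of `S_k(Γ₁(N))` given by a `ℤ`-basis of
`L` ((2.7.2), `integralBasis`) the operators of `𝒯` have integer matrices, so the eigenvector `f`
can be transported along `σ` (`LatticeEigen.exists_eigenvector_conj`); the transported form `g`
satisfies `T_p g = σ(a_p) g = τ(a_p) g` and `⟨d⟩ g = σ(ε(d)) g`, i.e. it is of type
`(k, ε')` with `ε' = σ ∘ ε`. [cite: DeligneSerreASENS1974, Prop. 2.7 (2.7.4)] -/
theorem prop27_conj_of_span_integralLattice1
    (hL : ∀ (N : ℕ) [NeZero N] (k : ℤ), DeligneSerre1974_span_integralLattice1 N k) :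
    prop27_conj := by
  intro N _ k ε f hfε hf0 heig K hK τ
  classical
  rcases le_or_gt k 0 with hk | hk
  · exact absurd (cuspForm_eq_zero_of_weight_nonpos hk f) hf0
  have hk1 : (1 : ℤ) ≤ k := hk
  have hspan := hL N k hk1
  have hfε' := mem_nebentypusSubspace_iff_diamondOp.mp hfε
  -- the operators `𝒯 = {T_p : p ∤ N} ∪ {⟨d⟩}` and their eigenvalues on `f`
  set 𝒯 : Set (Module.End ℂ (CuspForm (Gamma1 N) k)) :=
    {T | ∃ (p : ℕ) (hp : p.Prime), ¬ p ∣ N ∧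
        T = (haveI : NeZero p := ⟨hp.ne_zero⟩; heckeT (Gamma1 N) k p)} ∪
      {T | ∃ d : (ZMod N)ˣ, T = diamondOp N k (d : ZMod N)} with h𝒯
  have hTmem : ∀ (p : ℕ) (hp : p.Prime), ¬ p ∣ N →
      (haveI : NeZero p := ⟨hp.ne_zero⟩; heckeT (Gamma1 N) k p) ∈ 𝒯 :=
    fun p hp hpN ↦ Or.inl ⟨p, hp, hpN, rfl⟩
  have hdmem : ∀ d : (ZMod N)ˣ, diamondOp N k (d : ZMod N) ∈ 𝒯 := fun d ↦ Or.inr ⟨d, rfl⟩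
  have hstab : ∀ T ∈ 𝒯, ∀ x ∈ integralLattice1 N k, T x ∈ integralLattice1 N k := by
    rintro T (⟨p, hp, hpN, rfl⟩ | ⟨d, rfl⟩) x hx
    · haveI : NeZero p := ⟨hp.ne_zero⟩
      exact heckeT_mem_integralLattice1 hk1 hx p hp
    · exact diamondOp_mem_integralLattice1 hx d
  set lam : Module.End ℂ (CuspForm (Gamma1 N) k) → ℂ := LatticeEigen.eigenvalueOf f with hlam
  have hlam_p : ∀ (p : ℕ) (hp : p.Prime), ¬ p ∣ N →
      lam (haveI : NeZero p := ⟨hp.ne_zero⟩; heckeT (Gamma1 N) k p) = heckeEigenvalue f p := by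
    intro p hp hpN
    haveI : NeZero p := ⟨hp.ne_zero⟩
    exact LatticeEigen.eigenvalueOf_eq hf0 (heckeT_eq_heckeEigenvalue_smul f p (heig p hp hpN))
  have hlam_d : ∀ d : (ZMod N)ˣ, lam (diamondOp N k (d : ZMod N)) = ε (d : ZMod N) :=
    fun d ↦ LatticeEigen.eigenvalueOf_eq hf0 (hfε' d)
  have hlam_eig : ∀ T ∈ 𝒯, T f = lam T • f := by
    rintro T (⟨p, hp, hpN, rfl⟩ | ⟨d, rfl⟩)
    · exact LatticeEigen.apply_eq_eigenvalueOf_smul (heig p hp hpN)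
    · exact LatticeEigen.apply_eq_eigenvalueOf_smul ⟨_, hfε' d⟩
  have hint : ∀ T ∈ 𝒯, IsIntegral ℤ (lam T) := by
    rintro T (⟨p, hp, hpN, rfl⟩ | ⟨d, rfl⟩)
    · haveI : NeZero p := ⟨hp.ne_zero⟩
      exact isIntegral_of_heckeT_gamma1_apply_eq_smul (hL N k) hk1 hp hf0
        (hlam_eig _ (hTmem p hp hpN))
    · rw [hlam_d]
      exact isIntegral_dirichletCharacter_apply ε _
  -- the number field `K₁ = ℚ(λ_T : T ∈ 𝒯)` and the extension `σ` of `τ|ℚ(a_p)`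
  set S : Set ℂ := lam '' 𝒯 with hS
  have hSint : ∀ s ∈ S, IsIntegral ℚ s ∧ ((minpoly ℚ s).map (algebraMap ℚ ℂ)).Splits := by
    rintro _ ⟨T, hT, rfl⟩
    exact ⟨(hint T hT).tower_top, IsAlgClosed.splits _⟩
  set K₁ : IntermediateField ℚ ℂ := IntermediateField.adjoin ℚ S with hK₁
  have hlamK : ∀ T ∈ 𝒯, lam T ∈ K₁ := fun T hT ↦ IntermediateField.subset_adjoin ℚ S ⟨T, hT, rfl⟩
  set S₀ : Set ℂ := {a | ∃ p : ℕ, p.Prime ∧ ¬ p ∣ N ∧ a = heckeEigenvalue f p} with hS₀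
  have hS₀K : S₀ ≤ (K : Set ℂ) := by
    rintro _ ⟨p, hp, hpN, rfl⟩
    exact hK p hp hpN
  have hS₀S : S₀ ⊆ S := by
    rintro _ ⟨p, hp, hpN, rfl⟩
    exact ⟨_, hTmem p hp hpN, hlam_p p hp hpN⟩
  have hK₀K : IntermediateField.adjoin ℚ S₀ ≤ K := IntermediateField.adjoin_le_iff.mpr hS₀K
  have hK₀K₁ : IntermediateField.adjoin ℚ S₀ ≤ K₁ := IntermediateField.adjoin.mono ℚ _ _ hS₀S
  set f₀ : IntermediateField.adjoin ℚ S₀ →ₐ[ℚ] ℂ :=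
    (τ.comp (IntermediateField.inclusion hK₀K).toRingHom).toRatAlgHom with hf₀
  obtain ⟨σ, hσ⟩ := IntermediateField.exists_algHom_adjoin_of_splits hSint f₀ hK₀K₁
  have hσ_p : ∀ (p : ℕ) (hp : p.Prime) (hpN : ¬ p ∣ N),
      σ ⟨lam (haveI : NeZero p := ⟨hp.ne_zero⟩; heckeT (Gamma1 N) k p), hlamK _ (hTmem p hp hpN)⟩ =
        τ ⟨heckeEigenvalue f p, hK p hp hpN⟩ := by
    intro p hp hpN
    have hmem₀ : heckeEigenvalue f p ∈ IntermediateField.adjoin ℚ S₀ :=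
      IntermediateField.subset_adjoin ℚ S₀ ⟨p, hp, hpN, rfl⟩
    have h1 : (⟨lam (haveI : NeZero p := ⟨hp.ne_zero⟩; heckeT (Gamma1 N) k p),
        hlamK _ (hTmem p hp hpN)⟩ : K₁) =
        IntermediateField.inclusion hK₀K₁ ⟨heckeEigenvalue f p, hmem₀⟩ :=
      Subtype.ext (hlam_p p hp hpN)
    rw [h1, ← AlgHom.comp_apply, hσ]
    rfl
  -- transport of the eigenvector `f` along `σ`
  set b := integralBasis N k hspan with hb
  have hrat : ∀ T ∈ 𝒯, ∀ i j, ∃ q : ℚ, b.repr (T (b j)) i = q := fun T hT i j ↦ by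
    obtain ⟨n, hn⟩ := exists_int_repr_integralBasis hspan T (hstab T hT) i j
    exact ⟨n, by rw [hn, Rat.cast_intCast]⟩
  obtain ⟨g, hg0, hg⟩ :=
    LatticeEigen.exists_eigenvector_conj b 𝒯 hrat K₁ σ.toRingHom hf0 lam hlamK hlam_eig
  -- the conjugate character `ε' = σ ∘ ε`
  have hne : ∀ d : (ZMod N)ˣ,
      σ.toRingHom ⟨lam (diamondOp N k (d : ZMod N)), hlamK _ (hdmem d)⟩ ≠ 0 := by
    intro d h
    rw [map_eq_zero_iff _ σ.toRingHom.injective] at h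
    have h' : lam (diamondOp N k (d : ZMod N)) = 0 := congrArg Subtype.val h
    rw [hlam_d, ← MulChar.coe_toUnitHom] at h'
    exact (ε.toUnitHom d).ne_zero h'
  set ψ : (ZMod N)ˣ →* ℂˣ :=
    { toFun := fun d ↦ Units.mk0 _ (hne d)
      map_one' := by
        ext
        have h1 : (⟨lam (diamondOp N k ((1 : (ZMod N)ˣ) : ZMod N)), hlamK _ (hdmem 1)⟩ : K₁) = 1 := by
          apply Subtype.ext
          change lam (diamondOp N k ((1 : (ZMod N)ˣ) : ZMod N)) = ((1 : K₁) : ℂ)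
          rw [hlam_d, Units.val_one, map_one, OneMemClass.coe_one]
        rw [Units.val_mk0, Units.val_one (α := ℂ), h1, map_one]
      map_mul' := fun d e ↦ by
        ext
        have h1 : (⟨lam (diamondOp N k ((d * e : (ZMod N)ˣ) : ZMod N)), hlamK _ (hdmem (d * e))⟩ : K₁) =
            ⟨lam (diamondOp N k (d : ZMod N)), hlamK _ (hdmem d)⟩ *
              ⟨lam (diamondOp N k (e : ZMod N)), hlamK _ (hdmem e)⟩ := by
          apply Subtype.ext
          change lam (diamondOp N k ((d * e : (ZMod N)ˣ) : ZMod N)) =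
            lam (diamondOp N k (d : ZMod N)) * lam (diamondOp N k (e : ZMod N))
          rw [hlam_d, hlam_d, hlam_d, Units.val_mul, map_mul]
        rw [Units.val_mul (α := ℂ), Units.val_mk0, Units.val_mk0, Units.val_mk0, h1, map_mul] }
    with hψ
  refine ⟨MulChar.ofUnitHom ψ, g, ?_, hg0, fun p hp hpN ↦ ?_⟩
  · rw [mem_nebentypusSubspace_iff_diamondOp]
    intro d
    rw [hg _ (hdmem d), MulChar.ofUnitHom_coe]
    rfl
  · rw [hg _ (hTmem p hp hpN)]
    congr 1
    exact hσ_p p hp hpN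

end DeligneSerre1974

end Literature.NumberTheory.EllipticCurves.ModularForms
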